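import Mathlib.NumberTheory.ArithmeticFunction.Misc
import Mathlib.Data.Nat.Factorization.Basic
import Mathlib.Tactic.IntervalCases
import Mathlib.Tactic.Ring
import Mathlib.Tactic.Linarith
import Mathlib.Algebra.Order.Interval.Finset.SuccPred
import Literature.NumberTheory.Multiplicative.Balazard1990.Compute
import HarnessLib

/-!
# Balazard (1990), p. 27, Question 2 for `σ(x,k)`: definitions, the four readings, `Ω` by trial division,
# elementary facts

Source: M. Balazard, *Quelques exemples de suites unimodales en théorie des nombres*, Séminaire de Théorie des
Nombres de Bordeaux (2) **2** (1990) 13–30, doi:10.5802/jtnb.17 (open access) [Balazard1990], p. 27 Question 2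
(with p. 14: log-concavity, p. 20: `σ(x,k)`).  PRIMARY READ from the vendored page-image excerpt of the H21 archive
(`archive/2001-boxes/tp/literature/sources/balazard-1990-jtnb2-unimodales/EXCERPTS-prove-tp-omega-count-log-concavity.md`,
§BZ9 = p. 27, §BZ5 = p. 14, §BZ6 = p. 20).

The published question (verbatim, p. 27, closing §4 = Balazard's proof of Erdős's unimodality conjecture, Théorème E:
for `x` large, `π(x,k)`, `ρ(x,k)`, `σ(x,k)` are unimodal in `k`).  "Terminons ce paragraphe par une liste de
questions.  1. Des expériences sur ordinateur semblent indiquer que π(x,k), ρ(x,k) et σ(x,k) sont unimodales dès que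
x ≥ 1 : est-ce vrai ?  2. Ces trois suites sont-elles log-concaves ?" — with (p. 20) `σ(x,k) := Σ_{n ≤ x, Ω(n) = k} 1`
and (p. 14) "La suite de nombres réels positifs ou nuls (u_k)_{k∈I} est dite logarithmiquement concave … si
u_k² ≥ u_{k+1}.u_{k−1} pour tout k ∈ I tel que k ± 1 ∈ I, et si le support de u (l'ensemble des k pour lesquels
u_k ≠ 0) est un intervalle de Z."  CATEGORY: a published QUESTION answered in the negative — not a refuted claim.
Only the sequence `σ` (prime factors WITH multiplicity) is treated; Question 2 for `π(x,k)` and `ρ(x,k)` remains open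
(the 2001 study reports both log-concave for all `x ≤ 10⁷`; nothing about them is claimed here).

This module: `sigma x k = #{n ∈ [1,x] : Ω(n) = k}` (`Ω = ArithmeticFunction.cardFactors`; Balazard's `σ(x,k)` for
real `x ≥ 1` is `sigma ⌊x⌋ k`), `IsLogConcave u` (Balazard's definition with `I = ℕ`: the inequalities
`u_k u_{k+2} ≤ u_{k+1}²` AND interval support), the exceptional set `E` (77 elements, `card_E`, `max_E`; predicate
`InE`, Boolean `inEb` of `Compute`), the four readings of Question 2 — `Question2Sigma` (every `x ≥ 1`, as in his
Question 1), `Question2SigmaEventually` (all large `x`, as in Théorème E), and both with the sequence indexed from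
`k = 1` (`…₁`) — ALL FOUR ANSWERED IN THE NEGATIVE in this tree (`question2Sigma_false`, `question2Sigma₁_false` in
`FiniteRange`; `question2SigmaEventually_false`, `question2SigmaEventually₁_false` in `Blocks`): they are kept as
cited definitions (tombstones) because the answers name them; no `_holds` can exist, so they are not literature debt.
Then `omegaTD_eq` / `omegaC_eq : omegaC n = Ω n` (the structurally recursive trial division of `Compute` equals
Mathlib's `cardFactors`, so the kernel can evaluate `Ω`), and elementary facts: `sigma_zero/succ`,
`three_pow_cardFactors_le`, `sigma_eq_zero_of_lt`, `sigma_pos_of_le`, `sigma_ne_zero_iff : σ(x,k) ≠ 0 ↔ 2^k ≤ x`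
(so the support clause is automatic: `isLogConcave_sigma_iff`, `isLogConcave_sigma_shift_iff`).

Modules: `Literature.NumberTheory.Multiplicative.Balazard1990.Compute` (kernel-computable data: trial-division `Ω`, the row pass, the breakpoint table),
`KernelFin` / `KernelTab` (the `decide +kernel` evaluations), `Basic` (§§1–3: `sigma`, `IsLogConcave`, `E`, the four
readings `Question2Sigma…`, `omegaC = Ω`, elementary facts), `FiniteRange` (§§4–5: `x < 2^12`, the witness `x = 16`,
`question2Sigma_false`), `TopRange` (§§6–7: `σ(x,K−i)` as a step function, the 84 breakpoints), `Blocks` (§§8–9: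
the nine blocks, `isLogConcave_sigma_iff_mem_E`, `question2SigmaEventually_false`).

Provenance: refutations bundle `papers/_cross/refutations` (H21 seat pub-refute-2, 2026-08-18), package module
`Refutations.Balazard1990 (§§1–3)`, moved into the tree under the Lean-in-tree rule (human 2026-08-18).  The
classification `E` and the proof structure are the 2001 H21 programme's (archive route `tp/omega-count-log-concavity`,
Theorem 1, "review: upheld"); the bundle's exact Python certificate `numerics/balazard1990/check_balazard_sigma_Q2.py`
checks the same two legs independently.
-/

open scoped ArithmeticFunction.Omega

namespace Literature.NumberTheory.Multiplicative.Balazard1990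

/-! ## 1. Definitions -/

/-- Balazard's `σ(x,k) = #{1 ≤ n ≤ x : Ω(n) = k}` (p. 20), for a natural number `x`
(for real `x ≥ 1` his `σ(x,k)` is `sigma ⌊x⌋ k`); `Ω` is Mathlib's `ArithmeticFunction.cardFactors`. [cite: Balazard1990, p. 20] -/
def sigma (x k : ℕ) : ℕ := ((Finset.Icc 1 x).filter (fun n => Ω n = k)).card

/-- Balazard's log-concavity (p. 14) for a sequence `(u_k)_{k ∈ I}` of non-negative numbers with `I = ℕ`:
`u_k² ≥ u_{k+1} u_{k-1}` for every `k ∈ I` with `k ± 1 ∈ I` (written with middle index `k + 1`), AND the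
support `{k : u_k ≠ 0}` is an interval. [cite: Balazard1990, p. 14] -/
def IsLogConcave (u : ℕ → ℕ) : Prop :=
  (∀ k : ℕ, u k * u (k + 2) ≤ u (k + 1) ^ 2) ∧
  (∀ a b c : ℕ, a ≤ b → b ≤ c → u a ≠ 0 → u c ≠ 0 → u b ≠ 0)

/-- Membership in the 77-element exceptional set `E` of the 2001-programme paper (Theorem 1):
`E = {1–15, 18–24, 27–31, 36–39, 42–47, 54–59, 63, 72–74, 84–95, 112–119, 176–179, 184–185, 189–191, 224}`. [folklore] -/
def InE (x : ℕ) : Prop :=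
  (1 ≤ x ∧ x ≤ 15) ∨ (18 ≤ x ∧ x ≤ 24) ∨ (27 ≤ x ∧ x ≤ 31) ∨ (36 ≤ x ∧ x ≤ 39) ∨ (42 ≤ x ∧ x ≤ 47) ∨
  (54 ≤ x ∧ x ≤ 59) ∨ x = 63 ∨ (72 ≤ x ∧ x ≤ 74) ∨ (84 ≤ x ∧ x ≤ 95) ∨ (112 ≤ x ∧ x ≤ 119) ∨
  (176 ≤ x ∧ x ≤ 179) ∨ (184 ≤ x ∧ x ≤ 185) ∨ (189 ≤ x ∧ x ≤ 191) ∨ x = 224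

/-- Decidability / finiteness bookkeeping instance. [folklore] -/
instance : DecidablePred InE := fun x => by unfold InE; infer_instance

/-- The Boolean test `inEb` of `Compute.lean` decides `InE`. [folklore] -/
theorem inEb_iff (x : ℕ) : inEb x = true ↔ InE x := by
  simp only [inEb, InE, Bool.or_eq_true, Bool.and_eq_true, decide_eq_true_eq, beq_iff_eq, or_assoc]

/-- The exceptional set `E` as a `Finset ℕ`. [folklore] -/
def E : Finset ℕ := (Finset.range 225).filter InE

/-- Auxiliary lemma: `{x : ℕ} : x ∈ E ↔ InE x`. [folklore] -/
theorem mem_E {x : ℕ} : x ∈ E ↔ InE x := by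
  refine ⟨fun h => (Finset.mem_filter.mp h).2, fun h => Finset.mem_filter.mpr ⟨?_, h⟩⟩
  rw [Finset.mem_range]; unfold InE at h; omega

/-- Auxiliary lemma: `: E.card = 77`. [folklore] -/
theorem card_E : E.card = 77 := by decide

/-- Auxiliary lemma: `: ∀ x ∈ E, x ≤ 224`. [folklore] -/
theorem max_E : ∀ x ∈ E, x ≤ 224 := by
  intro x hx; rw [mem_E] at hx; unfold InE at hx; omega

/-- Auxiliary lemma: `: 224 ∈ E`. [folklore] -/
theorem mem_E_224 : 224 ∈ E := by decide

/-- Balazard's Question 2 (p. 27) for `σ`, reading (a): for EVERY real `x ≥ 1` (the range of his Question 1),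
is `k ↦ σ(x,k)` (`k ≥ 0`) log-concave?  **ANSWERED IN THE NEGATIVE in this tree:** `question2Sigma_false` (module
`FiniteRange`, witness `x = 16`).  Kept as a cited definition because the answer names it; no `_holds` can exist. [cite: Balazard1990, p. 27 Question 2] -/
def Question2Sigma : Prop := ∀ x : ℕ, 1 ≤ x → IsLogConcave (sigma x)

/-- Reading (b): for every SUFFICIENTLY LARGE `x` (the range of his Théorème E).  **ANSWERED IN THE NEGATIVE:**
`question2SigmaEventually_false` (module `Blocks`: not log-concave for any `x ≥ 225`).  Tombstone, no `_holds` can exist. [cite: Balazard1990, p. 27 Question 2] -/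
def Question2SigmaEventually : Prop := ∃ x₀ : ℕ, ∀ x : ℕ, x₀ ≤ x → IsLogConcave (sigma x)

/-- Reading (a) with the sequence indexed from `k = 1` (drops the inequality `σ(x,1)² ≥ σ(x,0)σ(x,2)`).  **ANSWERED IN THE
NEGATIVE:** `question2Sigma₁_false` (module `FiniteRange`).  Tombstone, no `_holds` can exist. [cite: Balazard1990, p. 27 Question 2] -/
def Question2Sigma₁ : Prop := ∀ x : ℕ, 1 ≤ x → IsLogConcave (fun k => sigma x (k + 1))

/-- Reading (b) with the sequence indexed from `k = 1`.  **ANSWERED IN THE NEGATIVE:** `question2SigmaEventually₁_false`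
(module `Blocks`).  Tombstone, no `_holds` can exist. [cite: Balazard1990, p. 27 Question 2] -/
def Question2SigmaEventually₁ : Prop :=
  ∃ x₀ : ℕ, ∀ x : ℕ, x₀ ≤ x → IsLogConcave (fun k => sigma x (k + 1))

/-! ## 2. A kernel-computable `Ω` (trial division) and its correctness -/

/-! `omegaTD fuel n d` (trial division under the invariant "every prime factor of `n` is `≥ d`", structural
recursion on `fuel`) and `omegaC n := omegaTD (2n+1) n 2` are defined in module `Compute`. -/

/-- Auxiliary lemma: `: ∀ (fuel n d : ℕ), 2 ≤ d → 2 * n < fuel + d → (∀ p : ℕ, p.Prime → p ∣ n → d ≤ p) → omegaTD fuel n d = Ω n`. [folklore] -/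
theorem omegaTD_eq : ∀ (fuel n d : ℕ), 2 ≤ d → 2 * n < fuel + d →
    (∀ p : ℕ, p.Prime → p ∣ n → d ≤ p) → omegaTD fuel n d = Ω n := by
  intro fuel
  induction fuel with
  | zero =>
    intro n d hd hfuel hmin
    rcases Nat.lt_or_ge n 2 with hn | hn
    · interval_cases n <;> simp [omegaTD]
    · exfalso
      have hp := Nat.minFac_prime (show n ≠ 1 by omega)
      have h1 := hmin _ hp (Nat.minFac_dvd n)
      have h2 := Nat.minFac_le (show 0 < n by omega)
      omega
  | succ fuel ih =>
    intro n d hd hfuel hmin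
    simp only [omegaTD]
    split_ifs with h1 h2 h3
    · interval_cases n <;> simp
    · -- `2 ≤ n < d²` and every prime factor `≥ d`: `n` is prime
      symm
      rw [ArithmeticFunction.cardFactors_eq_one_iff_prime]
      by_contra hnp
      have hsq := Nat.minFac_sq_le_self (show 0 < n by omega) hnp
      have hp := Nat.minFac_prime (show n ≠ 1 by omega)
      have hle := hmin _ hp (Nat.minFac_dvd n)
      have h4 : d * d ≤ n.minFac * n.minFac := Nat.mul_le_mul hle hle
      rw [sq] at hsq
      omega
    · -- `d ∣ n`; then `d` is prime (its least prime factor divides `n`, hence is `≥ d`)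
      have hdvd : d ∣ n := Nat.dvd_of_mod_eq_zero h3
      have hdp : d.Prime := by
        rw [Nat.prime_def_minFac]
        refine ⟨hd, ?_⟩
        have hmp := Nat.minFac_prime (show d ≠ 1 by omega)
        have h5 := hmin _ hmp (dvd_trans (Nat.minFac_dvd d) hdvd)
        have h6 := Nat.minFac_le (show 0 < d by omega)
        omega
      have hn_eq : d * (n / d) = n := Nat.mul_div_cancel' hdvd
      have hnd : n / d ≠ 0 := by
        intro h0; rw [h0, mul_zero] at hn_eq; omega
      have hd0 : d ≠ 0 := by omega
      rw [show Ω n = Ω (d * (n / d)) by rw [hn_eq], ArithmeticFunction.cardFactors_mul hd0 hnd,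
        ArithmeticFunction.cardFactors_apply_prime hdp, ih (n / d) d hd ?_ ?_]
      · ring
      · have h5 : n / d ≤ n / 2 := Nat.div_le_div_left hd (by norm_num)
        have h6 : 2 * (n / 2) ≤ n := Nat.mul_div_le n 2
        have h7 : d ≤ d * d := Nat.le_mul_self d
        omega
      · intro p hp hpd
        exact hmin p hp (dvd_trans hpd (Nat.div_dvd_of_dvd hdvd))
    · -- `d ∤ n`: every prime factor is `≥ d + 1`
      rw [ih n (d + 1) (by omega) (by omega) ?_]
      intro p hp hpn
      have h4 := hmin p hp hpn
      rcases Nat.eq_or_lt_of_le h4 with h5 | h5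
      · exact absurd (Nat.mod_eq_zero_of_dvd (h5 ▸ hpn)) h3
      · omega

/-- Auxiliary lemma: `(n : ℕ) : omegaC n = Ω n`. [folklore] -/
theorem omegaC_eq (n : ℕ) : omegaC n = Ω n :=
  omegaTD_eq _ _ _ le_rfl (by omega) (fun p hp _ => hp.two_le)

/-- Auxiliary lemma: `: omegaC = (fun n => Ω n)`. [folklore] -/
theorem omegaC_eq_fun : omegaC = (fun n => Ω n) := funext omegaC_eq

/-! ## 3. Elementary facts about `σ` -/

/-- Auxiliary lemma: `(k : ℕ) : sigma 0 k = 0`. [folklore] -/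
theorem sigma_zero (k : ℕ) : sigma 0 k = 0 := by simp [sigma]

/-- Auxiliary lemma: `(x k : ℕ) : sigma (x + 1) k = sigma x k + if Ω (x + 1) = k then 1 else 0`. [folklore] -/
theorem sigma_succ (x k : ℕ) : sigma (x + 1) k = sigma x k + if Ω (x + 1) = k then 1 else 0 := by
  have h : Finset.Icc 1 (x + 1) = insert (x + 1) (Finset.Icc 1 x) :=
    (Finset.insert_Icc_right_eq_Icc_add_one (by omega)).symm
  unfold sigma
  rw [h, Finset.filter_insert]
  split_ifs with hk
  · rw [Finset.card_insert_of_notMem (by simp)]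
  · rfl


/-- Auxiliary lemma: `{n : ℕ} (hn : Odd n) : 3 ^ Ω n ≤ n`. [folklore] -/
theorem three_pow_cardFactors_le {n : ℕ} (hn : Odd n) : 3 ^ Ω n ≤ n := by
  have hn0 : n ≠ 0 := by rintro rfl; exact absurd hn (by decide)
  have key : ∀ l : List ℕ, (∀ p ∈ l, 3 ≤ p) → 3 ^ l.length ≤ l.prod := by
    intro l
    induction l with
    | nil => simp
    | cons a l ih =>
      intro h
      simp only [List.length_cons, List.prod_cons, pow_succ]
      have ha := h a (by simp)
      have hl := ih (fun p hp => h p (by simp [hp]))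
      calc 3 ^ l.length * 3 = 3 * 3 ^ l.length := by ring
        _ ≤ a * l.prod := Nat.mul_le_mul ha hl
  have h1 := key n.primeFactorsList (fun p hmem => by
    have hp := Nat.prime_of_mem_primeFactorsList hmem
    have hpn : p ∣ n := Nat.dvd_of_mem_primeFactorsList hmem
    have hp2 : p ≠ 2 := by
      rintro rfl
      exact absurd (even_iff_two_dvd.mpr hpn) (Nat.not_even_iff_odd.mpr hn)
    have := hp.two_le
    omega)
  rw [Nat.prod_primeFactorsList hn0] at h1
  rwa [ArithmeticFunction.cardFactors_apply]

/-- Auxiliary lemma: `{x k : ℕ} (h : x < 2 ^ k) : sigma x k = 0`. [folklore] -/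
theorem sigma_eq_zero_of_lt {x k : ℕ} (h : x < 2 ^ k) : sigma x k = 0 := by
  unfold sigma
  rw [Finset.card_eq_zero, Finset.filter_eq_empty_iff]
  intro n hn hk
  rw [Finset.mem_Icc] at hn
  -- `2 ^ Ω n ≤ n` (every prime factor is `≥ 2`); the named lemma lives in an unrelated tree module
  -- (`Literature.Computability.Cryptography.Shor1997.two_pow_cardFactors_le`), so it is inlined here.
  have := (show ∀ m : ℕ, m ≠ 0 → 2 ^ Ω m ≤ m from fun m hm => by
    rw [ArithmeticFunction.cardFactors_apply]
    calc 2 ^ m.primeFactorsList.length ≤ m.primeFactorsList.prod :=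
          List.pow_card_le_prod _ _ fun p hp => (Nat.prime_of_mem_primeFactorsList hp).two_le
      _ = m := Nat.prod_primeFactorsList hm) n (show n ≠ 0 by omega)
  rw [hk] at this
  omega

/-- Auxiliary lemma: `{x k : ℕ} (h : 2 ^ k ≤ x) : 0 < sigma x k`. [folklore] -/
theorem sigma_pos_of_le {x k : ℕ} (h : 2 ^ k ≤ x) : 0 < sigma x k := by
  unfold sigma
  apply Finset.card_pos.mpr
  refine ⟨2 ^ k, Finset.mem_filter.mpr ⟨Finset.mem_Icc.mpr ⟨Nat.one_le_two_pow, h⟩, ?_⟩⟩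
  exact ArithmeticFunction.cardFactors_apply_prime_pow Nat.prime_two

/-- Auxiliary lemma: `{x k : ℕ} : sigma x k ≠ 0 ↔ 2 ^ k ≤ x`. [folklore] -/
theorem sigma_ne_zero_iff {x k : ℕ} : sigma x k ≠ 0 ↔ 2 ^ k ≤ x := by
  constructor
  · intro h
    by_contra h'
    exact h (sigma_eq_zero_of_lt (by omega))
  · intro h
    exact (sigma_pos_of_le h).ne'

/-- The support of `k ↦ σ(x,k)` (and of its shift) is automatically an interval (it is `{k : 2^k ≤ x}`). [folklore] -/
theorem sigma_support (x s a b c : ℕ) (_hab : a ≤ b) (hbc : b ≤ c) (_ha : sigma x (a + s) ≠ 0)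
    (hc : sigma x (c + s) ≠ 0) : sigma x (b + s) ≠ 0 := by
  rw [sigma_ne_zero_iff] at hc ⊢
  exact le_trans (Nat.pow_le_pow_right (by norm_num) (by omega)) hc

/-- Auxiliary lemma: `(x : ℕ) : IsLogConcave (sigma x) ↔ ∀ k : ℕ, sigma x k * sigma x (k + 2) ≤ sigma x (k + 1) ^ 2`. [folklore] -/
theorem isLogConcave_sigma_iff (x : ℕ) :
    IsLogConcave (sigma x) ↔ ∀ k : ℕ, sigma x k * sigma x (k + 2) ≤ sigma x (k + 1) ^ 2 := by
  refine ⟨fun h => h.1, fun h => ⟨h, fun a b c hab hbc ha hc => ?_⟩⟩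
  have := sigma_support x 0 a b c hab hbc (by simpa using ha) (by simpa using hc)
  simpa using this

/-- Auxiliary lemma: `(x : ℕ) : IsLogConcave (fun k => sigma x (k + 1)) ↔ ∀ k : ℕ, sigma x (k + 1) * sigma x (k + 3) ≤ sigma x (k + 2) ^ 2`. [folklore] -/
theorem isLogConcave_sigma_shift_iff (x : ℕ) :
    IsLogConcave (fun k => sigma x (k + 1)) ↔
      ∀ k : ℕ, sigma x (k + 1) * sigma x (k + 3) ≤ sigma x (k + 2) ^ 2 := by
  refine ⟨fun h => h.1, fun h => ⟨h, fun a b c hab hbc ha hc => ?_⟩⟩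
  exact sigma_support x 1 a b c hab hbc ha hc

end Literature.NumberTheory.Multiplicative.Balazard1990
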